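import Mathlib.Analysis.Fourier.FourierTransform
import Mathlib.MeasureTheory.Function.LpSeminorm.Basic
import Mathlib.Analysis.SpecialFunctions.Pow.Real
import HarnessLib

/-!
# The fractal uncertainty principle for `δ`-regular sets (Bourgain–Dyatlov 2018, Theorem 4)

Topic `Literature/Analysis/Fourier`. Named fact (D-0014: the statement as printed, no proof) from
J. Bourgain, S. Dyatlov, *Spectral gaps without the pressure condition*, Ann. of Math. 187 (2018),
Definition 1.1 and Theorem 4 (`(t:general-fup)`), in the paper's own Fourier convention
`f̂(ξ) = ∫ e^{-2πixξ} f(x) dx`, `f = ∫ e^{2πixξ} f̂(ξ) dξ` (§2.1 there) — which is Mathlib's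
`𝓕` / `𝓕⁻` on `ℝ → ℂ` (notation classes `FourierTransform.fourier` / `FourierTransformInv.fourierInv`, `Real.fourier_eq`, `Real.fourierInv_eq`).

* `IsRegularSet X δ C_R α₀ α₁` — Definition 1.1: `X ⊂ ℝ` nonempty closed is `δ`-regular with constant
  `C_R` on scales `α₀` to `α₁` if some Borel measure `μ_X` supported on `X` gives every interval
  `I = [a, b]` of size `|I| ∈ [α₀, α₁]` mass `μ_X(I) ≤ C_R |I|^δ`, and mass `μ_X(I) ≥ C_R⁻¹ |I|^δ` when
  moreover `I` is centred at a point of `X`.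
* `bourgainDyatlov2018_thm4` — Theorem 4: for `0 ≤ δ < 1`, `C_R ≥ 1` there are `β > 0` and `C`
  depending only on `δ, C_R` such that for all `N ≥ 1`, all `X ⊂ [-1, 1]` `δ`-regular with constant
  `C_R` on scales `N⁻¹` to `1` and all `Y ⊂ [-N, N]` `δ`-regular with constant `C_R` on scales `1` to
  `N`: every `f ∈ L²(ℝ)` with `supp f̂ ⊂ Y` has `‖f‖_{L²(X)} ≤ C N^{-β} ‖f‖_{L²(ℝ)}`.
  Lean form: we quantify over the Fourier side `g = f̂ ∈ L²(ℝ)` vanishing off `Y` (so `g ∈ L¹`, `Y`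
  being bounded, and `f = 𝓕⁻ g` is a genuine integral) and use Plancherel `‖f‖₂ = ‖g‖₂` to write the
  conclusion as `∫_X ‖𝓕⁻ g‖² ≤ (C N^{-β})² ∫ ‖g‖²`; this is the printed statement verbatim for the
  class `{f ∈ L² : supp f̂ ⊂ Y} = 𝓕⁻(L²(Y))`.

Grounds (as the continuum input of the foreseen split PorousToRegular → RegularFUPDiscrete → PorousFUP)
the crux `Summit.QuantumAdvantage.QuantumAdvantage.Theses.AreaUncertainty.PorousFUP`; porous sets sit
inside `δ`-regular sets with `δ < 1` (Dyatlov 2019, Prop. 1), which is how Dyatlov 2019, Thm 3 derives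
the porous FUP from this theorem.

Deliberately NOT here: the semiclassical rescaling `𝓕_h` (BD18 (2.5), Dyatlov 2019 Thm 1), the
hyperbolic FUP (BD18 Thm 3), explicit `β` (Jin–Zhang), porosity, and any discrete `ℤ/N` version.
-/

namespace Literature.Analysis.Fourier

open _root_.MeasureTheory Set
open scoped FourierTransform

/-- `IsRegularSet X δ C_R α₀ α₁`: `X ⊂ ℝ` is nonempty, closed, and `δ`-regular with constant `C_R` on
scales `α₀` to `α₁` — there is a Borel measure `μ` on `ℝ` with `μ(ℝ ∖ X) = 0`, `μ([a,b]) ≤ C_R (b-a)^δ`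
for every interval with `α₀ ≤ b - a ≤ α₁`, and `μ([a,b]) ≥ C_R⁻¹ (b-a)^δ` if moreover the midpoint
`(a+b)/2` lies in `X`. [cite: BourgainDyatlov2018, Definition 1.1] -/
def IsRegularSet (X : Set ℝ) (δ C_R α₀ α₁ : ℝ) : Prop :=
  X.Nonempty ∧ IsClosed X ∧
    ∃ μ : Measure ℝ, μ Xᶜ = 0 ∧
      ∀ a b : ℝ, a < b → α₀ ≤ b - a → b - a ≤ α₁ →
        μ (Icc a b) ≤ ENNReal.ofReal (C_R * (b - a) ^ δ) ∧
          ((a + b) / 2 ∈ X → ENNReal.ofReal (C_R⁻¹ * (b - a) ^ δ) ≤ μ (Icc a b))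

/-- **Fractal uncertainty principle for `δ`-regular sets** (Bourgain–Dyatlov 2018, Theorem 4, as
printed): let `0 ≤ δ < 1` and `C_R ≥ 1`. Then there exist `β > 0` and `C`, depending only on `δ` and
`C_R`, such that for every `N ≥ 1`, every `X ⊂ [-1, 1]` that is `δ`-regular with constant `C_R` on
scales `N⁻¹` to `1` and every `Y ⊂ [-N, N]` that is `δ`-regular with constant `C_R` on scales `1` to
`N`, all `f ∈ L²(ℝ)` with `supp f̂ ⊂ Y` satisfy `‖f‖_{L²(X)} ≤ C N^{-β} ‖f‖_{L²(ℝ)}`. Here `f` is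
presented through `g = f̂ ∈ L²`, `g = 0` off `Y`, `f = 𝓕⁻ g = ∫ e^{2πixξ} g(ξ) dξ` and
`‖f‖_{L²(ℝ)} = ‖g‖_{L²(ℝ)}` (Plancherel, the paper's convention (2.1)–(2.2)).
[cite: BourgainDyatlov2018, Theorem 4] -/
def bourgainDyatlov2018_thm4 : Prop :=
  ∀ (δ C_R : ℝ), 0 ≤ δ → δ < 1 → 1 ≤ C_R →
    ∃ β : ℝ, 0 < β ∧ ∃ C : ℝ, ∀ (N : ℝ), 1 ≤ N →
      ∀ (X Y : Set ℝ), X ⊆ Icc (-1) 1 → Y ⊆ Icc (-N) N →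
        IsRegularSet X δ C_R N⁻¹ 1 → IsRegularSet Y δ C_R 1 N →
        ∀ g : ℝ → ℂ, MemLp g 2 volume → (∀ ξ, ξ ∉ Y → g ξ = 0) →
          ∫ x in X, ‖(𝓕⁻ g : ℝ → ℂ) x‖ ^ 2 ≤
            (C * N ^ (-β)) ^ 2 * ∫ ξ, ‖g ξ‖ ^ 2

end Literature.Analysis.Fourier
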